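import Mathlib
import HarnessLib
import Literature.Algebra.EuclideanLattices.LatticePoissonSummationFamily
import Summits.AtomisticToContinuum.Crystallization.Theorems.HolmgrenBoyleLindHalfSpaceUniqueContinuationLayerSlices
import Summits.AtomisticToContinuum.Crystallization.Theorems.HolmgrenBoyleLindHalfSpaceUniqueContinuationLayerOrbits
import Summits.AtomisticToContinuum.Crystallization.Theorems.HolmgrenBoyleLindLineAnalytic
import Summits.AtomisticToContinuum.Crystallization.Theorems.HolmgrenBoyleLindOpenVanishing

/-!
# Route `HolmgrenBoyleLind`: Lennard-Jones force fields of separated sources, part 14 —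
the in-plane Fourier modes of the signed field of a lattice-invariant source on a horizontal plane

Support file for the crux item stmt-AtomisticToContinuum-6075 (`HalfSpaceUniqueContinuation`, line `registered`,
layered core; infrastructure written by a stub-worker of lead c3). SETTING: a unit normal `u`, the plane `W = (ℝ ∙ u)ᗮ`
with projection `P`, a full lattice `Λ ≤ W`, and a SIGNED SOURCE: two disjoint `Λ`-invariant sets `Dp` (`+`), `Dm` (`−`),
each `δ`-separated, in the closed half-space `{⟪y, u⟫ ≥ a}`. The signed Lennard-Jones field component at
`z = b + (a − X) u` (`b ∈ W`, depth `X > 0`) is `Ψ_e(b, X) = ∑_{y ∈ Dp ∪ Dm} ε_y ⟪e, K(z − y)⟫`,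
`K(v) = ((‖v‖²)⁻⁴ − (‖v‖²)⁻⁷) v`, `ε = ±1`.
* `hbl_countable_signedReps`, `hbl_signedField_summable`, `hbl_inner_signedField_eq_tsum` — countable representatives
  `{q ∈ Dp ∪ Dm | P q ∈ fdom Λ}`, absolute summability at `z`, `⟪e, ∑_{Dp} K(z−y) − ∑_{Dm} K(z−y)⟫ = Ψ_e(b, X)`;
* `hbl_summable_reps_inv_pow_four`, `hbl_signedModes_summable_norm` — polynomial height sums over representatives
  (window count `hbl_exists_reps_height_count`) and `∑_{q,k} ‖ε_q e_{−k}(P q) 𝓕[slice_q](dualVec Λ k)‖ < ∞`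
  (shell bound `hbl_exists_norm_fourierIntegral_slice_le`, `summable_exp_neg_mul_norm_dualVec`);
* **`hbl_signedField_hasSum_modes`** — the MODE EXPANSION `Ψ_e(b, X) = (vol fdom)⁻¹ ∑ₖ A_k(X) e_k(b)`,
  `A_k(X) = ∑_q ε_q e_{−k}(P q) 𝓕[slice_q](dualVec Λ k)`, `slice_q(v) = (⟪P e, v⟫ + τ_q ⟪e,u⟫)((‖v‖² + τ_q²)^{-4} −
  (‖v‖² + τ_q²)^{-7})`, `τ_q = −(X + ⟪q,u⟫ − a)` (`hbl_inner_kernel_coe_add_smul`): Poisson summation for the family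
  `(ε_q slice_q(· − P q))_q` (`LatticePeriodic.hasSum_echar_tsum_tsum_of_summable`) along the orbit decomposition
  `reps × Λ ≃ Dp ∪ Dm` (`hbl_exists_repsEquiv`), joint majorants from `hbl_norm_slice_le` + `hbl_summable_inv_pow_seven`.
All `[folklore]`; nothing here closes an item.
-/

noncomputable section

namespace Summit.AtomisticToContinuum.Crystallization.Theorems.HolmgrenBoyleLind

open scoped BigOperators Topology InnerProductSpace RealInnerProductSpace FourierTransform
open MeasureTheory Filter Set Literature.Algebra.EuclideanLattices.LatticePeriodic
open scoped Classical

variable {u : EuclideanSpace ℝ (Fin 3)}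

section Helpers

/-- Translation and a constant factor under the Fourier integral, at a dual vector:
`𝓕[c f(· − v₀)](dualVec L k) = c · echar L (−k) v₀ · 𝓕[f](dualVec L k)`. [folklore] -/
theorem hbl_fourier_const_mul_translate {V : Type*} [NormedAddCommGroup V] [InnerProductSpace ℝ V]
    [FiniteDimensional ℝ V] [MeasurableSpace V] [BorelSpace V] (L : Submodule ℤ V) [DiscreteTopology L]
    [IsZLattice ℝ L] (c : ℂ) (f : V → ℂ) (v₀ : V) (k : Fin (Module.finrank ℝ V) → ℤ) :
    𝓕 (fun v => c * f (v - v₀)) (dualVec L k) = c * echar L (-k) v₀ * 𝓕 f (dualVec L k) := by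
  rw [hbl_fourier_const_mul_apply, mul_assoc]
  congr 1
  have h : 𝓕 (fun v => f (v - v₀)) (dualVec L k) = Real.fourierChar (⟪-v₀, dualVec L k⟫) • 𝓕 f (dualVec L k) := by
    have := congrFun (VectorFourier.fourierIntegral_comp_add_right Real.fourierChar volume (innerₗ V) f (-v₀))
      (dualVec L k)
    simp only [Function.comp_def, ← sub_eq_add_neg, innerₗ_apply_apply] at this
    exact this
  rw [h, Circle.smul_def, smul_eq_mul, echar_eq_cexp_inner_dualVec, Real.fourierChar_apply, dualVec_neg,
    inner_neg_left, inner_neg_left, real_inner_comm (dualVec L k) v₀]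
  congr 2; push_cast; ring

/-- The decomposition of `x + (a − X)u − (q − ℓ)` along the plane and the normal. [folklore] -/
theorem hbl_plane_decomp (hu : ‖u‖ = 1) (x ℓ : (ℝ ∙ u)ᗮ) (q : EuclideanSpace ℝ (Fin 3)) (a X : ℝ) :
    (x : EuclideanSpace ℝ (Fin 3)) + (a - X) • u - (q + ((-ℓ : (ℝ ∙ u)ᗮ) : EuclideanSpace ℝ (Fin 3))) =
      ((x + ℓ - (ℝ ∙ u)ᗮ.orthogonalProjectionOnto q : (ℝ ∙ u)ᗮ) : EuclideanSpace ℝ (Fin 3)) + (-(X + (⟪q, u⟫ - a))) • u := by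
  (conv_lhs => rw [hbl_eq_proj_add_inner_smul hu q]); push_cast; module

/-- **The translated slice against the packing majorant**: for `‖x‖ ≤ R`, `a ≤ ⟪q,u⟫`, `X > 0`,
`|slice_q(x + ℓ − P q)| ≤ (1 + X⁻⁶)(‖c‖ + |e_u|) (max X (dist (q − ℓ) ((a−X)u) / 2 − R))⁻⁷` (`hbl_norm_slice_le`, Pythagoras
on the slice `ρ² = ‖v‖² + τ²`, `max X (d/2 − R) ≤ ρ`). [folklore] -/
theorem hbl_norm_slice_translate_le (hu : ‖u‖ = 1) (c x ℓ : (ℝ ∙ u)ᗮ) (eu : ℝ) {X R a : ℝ} (hX : 0 < X) {q : EuclideanSpace ℝ (Fin 3)}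
    (hq : a ≤ ⟪q, u⟫) (hx : ‖x‖ ≤ R) :
    ‖(⟪c, x + ℓ - (ℝ ∙ u)ᗮ.orthogonalProjectionOnto q⟫ + (-(X + (⟪q, u⟫ - a))) * eu) * ((‖x + ℓ - (ℝ ∙ u)ᗮ.orthogonalProjectionOnto q‖ ^ 2 + (-(X + (⟪q, u⟫ - a))) ^ 2) ^ (-(4 : ℝ)) -
        (‖x + ℓ - (ℝ ∙ u)ᗮ.orthogonalProjectionOnto q‖ ^ 2 + (-(X + (⟪q, u⟫ - a))) ^ 2) ^ (-(7 : ℝ)))‖ ≤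
      (1 + X⁻¹ ^ 6) * (‖c‖ + |eu|) * ((max X (dist (q + ((-ℓ : (ℝ ∙ u)ᗮ) : EuclideanSpace ℝ (Fin 3))) ((a - X) • u) / 2 - R))⁻¹) ^ 7 := by
  set τ : ℝ := -(X + (⟪q, u⟫ - a)) with hτ
  set v : (ℝ ∙ u)ᗮ := x + ℓ - (ℝ ∙ u)ᗮ.orthogonalProjectionOnto q with hv
  have hτX : X ≤ |τ| := by rw [hτ, abs_neg, abs_of_pos (by linarith)]; linarith
  have hgeo : (x : EuclideanSpace ℝ (Fin 3)) + (a - X) • u - (q + ((-ℓ : (ℝ ∙ u)ᗮ) : EuclideanSpace ℝ (Fin 3))) = (v : EuclideanSpace ℝ (Fin 3)) + τ • u := hbl_plane_decomp hu x ℓ q a X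
  have hρ2 := hbl_norm_sq_coe_add_smul hu v τ
  have hXρ : X ≤ ‖(v : EuclideanSpace ℝ (Fin 3)) + τ • u‖ :=
    hτX.trans (abs_le_of_sq_le_sq (by rw [hρ2]; nlinarith [sq_nonneg ‖v‖]) (norm_nonneg _))
  have hρ0 : 0 < ‖(v : EuclideanSpace ℝ (Fin 3)) + τ • u‖ := hX.trans_le hXρ
  have hd : dist (q + ((-ℓ : (ℝ ∙ u)ᗮ) : EuclideanSpace ℝ (Fin 3))) ((a - X) • u) ≤ R + ‖(v : EuclideanSpace ℝ (Fin 3)) + τ • u‖ := by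
    have h1 : q + ((-ℓ : (ℝ ∙ u)ᗮ) : EuclideanSpace ℝ (Fin 3)) - (a - X) • u = (x : EuclideanSpace ℝ (Fin 3)) - ((v : EuclideanSpace ℝ (Fin 3)) + τ • u) := by rw [← hgeo]; abel
    have hxn : ‖(x : EuclideanSpace ℝ (Fin 3))‖ ≤ R := hx
    rw [dist_eq_norm, h1]; exact (norm_sub_le _ _).trans (add_le_add hxn le_rfl)
  have hm : 0 < max X (dist (q + ((-ℓ : (ℝ ∙ u)ᗮ) : EuclideanSpace ℝ (Fin 3))) ((a - X) • u) / 2 - R) := hX.trans_le (le_max_left _ _)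
  have hmρ : max X (dist (q + ((-ℓ : (ℝ ∙ u)ᗮ) : EuclideanSpace ℝ (Fin 3))) ((a - X) • u) / 2 - R) ≤ ‖(v : EuclideanSpace ℝ (Fin 3)) + τ • u‖ :=
    max_le hXρ (by linarith only [hd, dist_nonneg (x := q + ((-ℓ : (ℝ ∙ u)ᗮ) : EuclideanSpace ℝ (Fin 3))) (y := (a - X) • u)])
  have hpow : (‖v‖ ^ 2 + τ ^ 2) ^ (-(7 / 2 : ℝ)) ≤ ((max X (dist (q + ((-ℓ : (ℝ ∙ u)ᗮ) : EuclideanSpace ℝ (Fin 3))) ((a - X) • u) / 2 - R))⁻¹) ^ 7 := by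
    rw [← hρ2, ← Real.rpow_natCast _ 2, ← Real.rpow_mul hρ0.le, show ((2 : ℕ) : ℝ) * -(7 / 2 : ℝ) = -((7 : ℕ) : ℝ) by
      norm_num, Real.rpow_neg hρ0.le, Real.rpow_natCast, ← inv_pow]
    exact pow_le_pow_left₀ (inv_nonneg.2 hρ0.le) ((inv_le_inv₀ hρ0 hm).2 hmρ) 7
  exact (hbl_norm_slice_le c eu hX hτX v).trans (mul_le_mul_of_nonneg_left hpow (by positivity))

/-- **Polynomial height sums over representatives.** If `D ⊆ {⟪y,u⟫ ≥ a}` has at most `N` canonical representatives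
in every height window of length `1`, then `∑_q (X + (⟪q,u⟫ − a))⁻⁴ < ∞` over the representatives (`X > 0`; window `j`
contributes `≤ N (X + j)⁻⁴`). [folklore] -/
theorem hbl_summable_reps_inv_pow_four (Λ : Submodule ℤ (ℝ ∙ u)ᗮ) [DiscreteTopology Λ] [IsZLattice ℝ Λ] {D : Set (EuclideanSpace ℝ (Fin 3))} {a : ℝ}
    (ha : ∀ y ∈ D, a ≤ ⟪y, u⟫) {N : ℕ}
    (hN : ∀ Y : ℝ, {q : EuclideanSpace ℝ (Fin 3) | (q ∈ D ∧ (ℝ ∙ u)ᗮ.orthogonalProjectionOnto q ∈ fdom Λ) ∧ Y ≤ ⟪q, u⟫ ∧ ⟪q, u⟫ ≤ Y + 1}.encard ≤ N) {X : ℝ} (hX : 0 < X) :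
    Summable (fun q : {q : EuclideanSpace ℝ (Fin 3) // q ∈ D ∧ (ℝ ∙ u)ᗮ.orthogonalProjectionOnto q ∈ fdom Λ} => ((X + (⟪(q : EuclideanSpace ℝ (Fin 3)), u⟫ - a))⁻¹) ^ 4) := by
  set T := {q : EuclideanSpace ℝ (Fin 3) // q ∈ D ∧ (ℝ ∙ u)ᗮ.orthogonalProjectionOnto q ∈ fdom Λ}
  set f : T → ℝ := fun q => ((X + (⟪(q : EuclideanSpace ℝ (Fin 3)), u⟫ - a))⁻¹) ^ 4
  set g : ℕ → ℝ := fun j => ((X + j)⁻¹) ^ 4 with hg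
  have hg0 : ∀ j, 0 ≤ g j := fun j => by positivity
  have hgs : Summable g := by
    have hm : 0 < min X 1 := lt_min hX one_pos
    refine Summable.of_nonneg_of_le hg0 (fun j => ?_)
      (((Real.summable_nat_pow_inv.2 (by norm_num : 1 < 4)).comp_injective Nat.succ_injective).mul_left ((min X 1)⁻¹ ^ 4))
    have h1 : min X 1 * ((j : ℝ) + 1) ≤ X + j := by
      nlinarith [min_le_left X 1, min_le_right X 1, (Nat.cast_nonneg j : (0 : ℝ) ≤ j)]
    simp only [hg, Function.comp_apply, Nat.succ_eq_add_one, Nat.cast_add, Nat.cast_one, ← inv_pow, ← mul_pow, ← mul_inv]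
    exact pow_le_pow_left₀ (by positivity) ((inv_le_inv₀ (by positivity) (by positivity)).2 h1) 4
  refine summable_of_sum_le (fun q => by positivity) (c := N * ∑' j, g j) fun F => ?_
  let jf : T → ℕ := fun q => ⌊⟪(q : EuclideanSpace ℝ (Fin 3)), u⟫ - a⌋₊
  have hmaps : ∀ q ∈ F, jf q ∈ Finset.range (F.sup jf + 1) := fun q hq =>
    Finset.mem_range.2 (Nat.lt_succ_of_le (Finset.le_sup hq))
  rw [← Finset.sum_fiberwise_of_maps_to hmaps]
  have hfib : ∀ j ∈ Finset.range (F.sup jf + 1), ∑ q ∈ F with jf q = j, f q ≤ N * g j := by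
    intro j _
    have hj : ∀ q ∈ F.filter (fun q => jf q = j), (j : ℝ) ≤ ⟪(q : EuclideanSpace ℝ (Fin 3)), u⟫ - a ∧ ⟪(q : EuclideanSpace ℝ (Fin 3)), u⟫ - a < j + 1 :=
      fun q hq => by
        have h := (Finset.mem_filter.1 hq).2
        exact ⟨h ▸ Nat.floor_le (sub_nonneg.2 (ha _ q.2.1)), h ▸ Nat.lt_floor_add_one _⟩
    have hXj : 0 < X + j := by positivity
    have hwin : ∀ q ∈ F.filter (fun q => jf q = j), f q ≤ g j := fun q hq =>
      pow_le_pow_left₀ (inv_nonneg.2 (by linarith [(hj q hq).1]))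
        ((inv_le_inv₀ (by linarith [(hj q hq).1]) hXj).2 (by linarith [(hj q hq).1])) 4
    have hcard : ((F.filter (fun q => jf q = j)).card : ℝ) ≤ N := by
      have h1 : ((F.filter fun q => jf q = j).map (Function.Embedding.subtype _) : Set (EuclideanSpace ℝ (Fin 3))).encard ≤ N := by
        refine (Set.encard_le_encard fun x hx => ?_).trans (hN (a + j))
        obtain ⟨q, hq, rfl⟩ := Finset.mem_map.1 (Finset.mem_coe.1 hx)
        exact ⟨q.2, by simp only [Function.Embedding.coe_subtype]; linarith [(hj q hq).1],
          by simp only [Function.Embedding.coe_subtype]; linarith [(hj q hq).2]⟩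
      rw [Set.encard_coe_eq_coe_finsetCard, Finset.card_map] at h1
      exact_mod_cast h1
    calc ∑ q ∈ F with jf q = j, f q ≤ ∑ q ∈ F with jf q = j, g j := Finset.sum_le_sum hwin
      _ ≤ N * g j := by rw [Finset.sum_const, nsmul_eq_mul]; exact mul_le_mul_of_nonneg_right hcard (hg0 j)
  calc ∑ j ∈ Finset.range (F.sup jf + 1), ∑ q ∈ F with jf q = j, f q
      ≤ ∑ j ∈ Finset.range (F.sup jf + 1), N * g j := Finset.sum_le_sum hfib
    _ ≤ N * ∑' j, g j := by
        rw [← Finset.mul_sum]; exact mul_le_mul_of_nonneg_left (hgs.sum_le_tsum _ fun j _ => hg0 j) N.cast_nonneg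

end Helpers

section Modes

variable (hu : ‖u‖ = 1) (Λ : Submodule ℤ (ℝ ∙ u)ᗮ)
  [DiscreteTopology Λ] [IsZLattice ℝ Λ] {Dp Dm : Set (EuclideanSpace ℝ (Fin 3))} {δ a : ℝ}
  (hδ : 0 < δ) (hdisj : Disjoint Dp Dm)
  (hsepp : ∀ x ∈ Dp, ∀ y ∈ Dp, x ≠ y → δ ≤ dist x y)
  (hsepm : ∀ x ∈ Dm, ∀ y ∈ Dm, x ≠ y → δ ≤ dist x y)
  (hap : ∀ y ∈ Dp, a ≤ ⟪y, u⟫) (ham : ∀ y ∈ Dm, a ≤ ⟪y, u⟫)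
  (hDp : ∀ ℓ : Λ, ∀ y : EuclideanSpace ℝ (Fin 3), y + ((ℓ : (ℝ ∙ u)ᗮ) : EuclideanSpace ℝ (Fin 3)) ∈ Dp ↔ y ∈ Dp)
  (hDm : ∀ ℓ : Λ, ∀ y : EuclideanSpace ℝ (Fin 3), y + ((ℓ : (ℝ ∙ u)ᗮ) : EuclideanSpace ℝ (Fin 3)) ∈ Dm ↔ y ∈ Dm)

include hδ hsepp hsepm in
/-- The canonical representatives of a signed separated source are countable. [folklore] -/
theorem hbl_countable_signedReps : Countable {q : EuclideanSpace ℝ (Fin 3) // q ∈ Dp ∪ Dm ∧ (ℝ ∙ u)ᗮ.orthogonalProjectionOnto q ∈ fdom Λ} := by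
  have h : Set.Countable {q : EuclideanSpace ℝ (Fin 3) | q ∈ Dp ∪ Dm ∧ (ℝ ∙ u)ᗮ.orthogonalProjectionOnto q ∈ fdom Λ} :=
    ((hbl_countable_of_separated hδ hsepp).union (hbl_countable_of_separated hδ hsepm)).mono fun q hq => hq.1
  exact h.to_subtype

include hδ hsepp hsepm in
/-- The packing majorant `C (max X (dist y p / 2 − R))⁻⁷` is summable over `Dp ∪ Dm` (`hbl_summable_inv_pow_seven` on `Dp`
and on `Dm ∖ Dp`). [folklore] -/
theorem hbl_summable_majorant_union (R : ℝ) {X C : ℝ} (hX : 0 < X) (hC : 0 ≤ C) (p : EuclideanSpace ℝ (Fin 3)) :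
    Summable (fun y : ↥(Dp ∪ Dm) => C * ((max X (dist (y : EuclideanSpace ℝ (Fin 3)) p / 2 - R))⁻¹) ^ 7) := by
  have h1 := hbl_summable_inv_pow_seven R hδ hX hsepp (fun y : Dp => (y : EuclideanSpace ℝ (Fin 3))) Subtype.val_injective (fun y => y.2) p hC
  have h2 := hbl_summable_inv_pow_seven R hδ hX (X := Dm \ Dp) (fun a ha b hb hab => hsepm a ha.1 b hb.1 hab)
    (fun y : ↥(Dm \ Dp) => (y : EuclideanSpace ℝ (Fin 3))) Subtype.val_injective (fun y => y.2) p hC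
  have h := (h1.hasSum.add_disjoint (f := fun y : EuclideanSpace ℝ (Fin 3) => C * ((max X (dist y p / 2 - R))⁻¹) ^ 7)
    Set.disjoint_sdiff_right h2.hasSum).summable
  rwa [Set.union_sdiff_self] at h

include hu in
/-- Over a `δ`-separated `D ⊆ {⟪y,u⟫ ≥ a}` the kernel vectors `K(z − y)`, `z = b + (a − X)u`, `X > 0`, are absolutely
summable (all points of `D` are at distance `≥ X` from `z`; `hbl_summable_inv_pow_seven`). [folklore] -/
theorem hbl_summable_kernel_of_height {D : Set (EuclideanSpace ℝ (Fin 3))} (hδ : 0 < δ) (hsep : ∀ x ∈ D, ∀ y ∈ D, x ≠ y → δ ≤ dist x y)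
    (ha : ∀ y ∈ D, a ≤ ⟪y, u⟫) (b : (ℝ ∙ u)ᗮ) {X : ℝ} (hX : 0 < X) {z : EuclideanSpace ℝ (Fin 3)} (hz : z = (b : EuclideanSpace ℝ (Fin 3)) + (a - X) • u) :
    Summable (fun y : D => ((((‖z - (y : EuclideanSpace ℝ (Fin 3))‖ ^ 2) ^ 4)⁻¹ - ((‖z - (y : EuclideanSpace ℝ (Fin 3))‖ ^ 2) ^ 7)⁻¹) • (z - (y : EuclideanSpace ℝ (Fin 3))))) := by
  have hzu : ⟪z, u⟫ = a - X := by
    rw [hz, inner_add_left, hbl_inner_coe_orthogonal, real_inner_smul_left, real_inner_self_eq_norm_sq, hu]; ring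
  have hD : ∀ y ∈ D, X ≤ dist y z := fun y hy => by
    have h1 : |⟪y - z, u⟫| ≤ ‖y - z‖ * ‖u‖ := abs_real_inner_le_norm _ _
    rw [hu, mul_one, inner_sub_left, hzu] at h1
    rw [dist_eq_norm]
    linarith only [h1, le_abs_self (⟪y, u⟫ - (a - X)), ha y hy]
  refine Summable.of_norm_bounded (hbl_summable_inv_pow_seven 0 hδ hX hsep (fun y : D => (y : EuclideanSpace ℝ (Fin 3))) Subtype.val_injective
    (fun y => y.2) z (by positivity : (0 : ℝ) ≤ (X⁻¹) ^ 6 + 1)) fun y => ?_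
  have hd := hD y y.2
  have hne : (y : EuclideanSpace ℝ (Fin 3)) ≠ z := fun h => by rw [h, dist_self] at hd; exact absurd hd (not_le.2 hX)
  rw [← ljForce_eq_kernel hne]
  exact hbl_norm_ljForce_le_majorant hX hd

include hu hδ hsepp hsepm hap ham in
/-- **Absolute summability of the signed field** at a point `z = b + (a − X) u` of depth `X > 0` below the plane:
`∑_{y ∈ Dp ∪ Dm} ‖K(z − y)‖ < ∞` (on `Dp` and on `Dm ∖ Dp`). [folklore] -/
theorem hbl_signedField_summable (b : (ℝ ∙ u)ᗮ) {X : ℝ} (hX : 0 < X) (z : EuclideanSpace ℝ (Fin 3)) (hz : z = (b : EuclideanSpace ℝ (Fin 3)) + (a - X) • u) :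
    Summable (fun y : ↥(Dp ∪ Dm) => ((((‖z - (y : EuclideanSpace ℝ (Fin 3))‖ ^ 2) ^ 4)⁻¹ - ((‖z - (y : EuclideanSpace ℝ (Fin 3))‖ ^ 2) ^ 7)⁻¹) • (z - (y : EuclideanSpace ℝ (Fin 3))))) := by
  have h1 := hbl_summable_kernel_of_height hu hδ hsepp hap b hX hz
  have h2 := hbl_summable_kernel_of_height hu hδ (D := Dm \ Dp) (fun a ha b hb hab => hsepm a ha.1 b hb.1 hab)
    (fun y hy => ham y hy.1) b hX hz
  have h := (h1.hasSum.add_disjoint (f := fun y : EuclideanSpace ℝ (Fin 3) => ((((‖z - y‖ ^ 2) ^ 4)⁻¹ - ((‖z - y‖ ^ 2) ^ 7)⁻¹) • (z - y)))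
    Set.disjoint_sdiff_right h2.hasSum).summable
  rwa [Set.union_sdiff_self] at h

include hu hδ hdisj hsepp hsepm hap ham in
/-- **The field component as a signed scalar series**:
`⟪e, ∑_{Dp} K(z − y) − ∑_{Dm} K(z − y)⟫ = ∑_{y ∈ Dp ∪ Dm} ε_y ⟪e, K(z − y)⟫`. [folklore] -/
theorem hbl_inner_signedField_eq_tsum (e : EuclideanSpace ℝ (Fin 3)) (b : (ℝ ∙ u)ᗮ) {X : ℝ} (hX : 0 < X) (z : EuclideanSpace ℝ (Fin 3))
    (hz : z = (b : EuclideanSpace ℝ (Fin 3)) + (a - X) • u) :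
    ((⟪e, (∑' y : Dp, ((((‖z - (y : EuclideanSpace ℝ (Fin 3))‖ ^ 2) ^ 4)⁻¹ - ((‖z - (y : EuclideanSpace ℝ (Fin 3))‖ ^ 2) ^ 7)⁻¹) • (z - (y : EuclideanSpace ℝ (Fin 3))))) -
      (∑' y : Dm, ((((‖z - (y : EuclideanSpace ℝ (Fin 3))‖ ^ 2) ^ 4)⁻¹ - ((‖z - (y : EuclideanSpace ℝ (Fin 3))‖ ^ 2) ^ 7)⁻¹) • (z - (y : EuclideanSpace ℝ (Fin 3)))))⟫ : ℝ) : ℂ) =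
      ∑' y : ↥(Dp ∪ Dm), (if (y : EuclideanSpace ℝ (Fin 3)) ∈ Dp then (1 : ℂ) else -1) *
        ((⟪e, ((((‖z - (y : EuclideanSpace ℝ (Fin 3))‖ ^ 2) ^ 4)⁻¹ - ((‖z - (y : EuclideanSpace ℝ (Fin 3))‖ ^ 2) ^ 7)⁻¹) • (z - (y : EuclideanSpace ℝ (Fin 3))))⟫ : ℝ) : ℂ) := by
  set K : EuclideanSpace ℝ (Fin 3) → EuclideanSpace ℝ (Fin 3) := fun y => ((((‖z - y‖ ^ 2) ^ 4)⁻¹ - ((‖z - y‖ ^ 2) ^ 7)⁻¹) • (z - y))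
  set G : EuclideanSpace ℝ (Fin 3) → ℂ := fun y => (if y ∈ Dp then (1 : ℂ) else -1) * ((⟪e, K y⟫ : ℝ) : ℂ) with hG
  have hsP : Summable fun y : Dp => K y := hbl_summable_kernel_of_height hu hδ hsepp hap b hX hz
  have hsM : Summable fun y : Dm => K y := hbl_summable_kernel_of_height hu hδ hsepm ham b hX hz
  have hGs : ∀ {D : Set (EuclideanSpace ℝ (Fin 3))}, Summable (fun y : D => K y) → Summable (fun y : D => G y) :=
    fun h => Summable.of_norm_bounded ((h.norm).mul_left ‖e‖) fun y => by
      have h1 : ‖(if (y : EuclideanSpace ℝ (Fin 3)) ∈ Dp then (1 : ℂ) else -1)‖ = 1 := by split_ifs <;> simp only [norm_neg, norm_one]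
      rw [hG, norm_mul, Complex.norm_real, h1, one_mul]
      exact norm_inner_le_norm _ _
  change ((⟪e, (∑' y : Dp, K y) - ∑' y : Dm, K y⟫ : ℝ) : ℂ) = ∑' y : ↥(Dp ∪ Dm), G y
  rw [Summable.tsum_union_disjoint (f := G) hdisj (hGs hsP) (hGs hsM), inner_sub_right, ← innerSL_apply_apply ℝ e,
    ← innerSL_apply_apply ℝ e, (innerSL ℝ e).map_tsum hsP, (innerSL ℝ e).map_tsum hsM]
  push_cast; rw [sub_eq_add_neg, ← tsum_neg]; congr 1
  · exact tsum_congr fun y => by simp [hG, y.2, innerSL_apply_apply]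
  · exact tsum_congr fun y => by simp [hG, Set.disjoint_right.1 hdisj y.2, innerSL_apply_apply]

include hu hδ hsepp hsepm hap ham in
/-- **Joint absolute summability of the mode coefficients** `(q, k) ↦ ε_q e_{−k}(P q) 𝓕[slice_q](dualVec Λ k)` for the
slices at depth `X > 0` (shell bound `K (‖P e‖ ‖w‖ + |⟪e,u⟫|) |τ_q|⁻⁴ e^{−π ‖w‖ |τ_q|}`, `|τ_q| ≥ X`; height count in `q`,
`summable_exp_neg_mul_norm_dualVec` in `k`). [folklore] -/
theorem hbl_signedModes_summable_norm (e : EuclideanSpace ℝ (Fin 3)) {X : ℝ} (hX : 0 < X) :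
    Summable (fun p : {q : EuclideanSpace ℝ (Fin 3) // q ∈ Dp ∪ Dm ∧ (ℝ ∙ u)ᗮ.orthogonalProjectionOnto q ∈ fdom Λ} × (Fin (Module.finrank ℝ (ℝ ∙ u)ᗮ) → ℤ) =>
      ‖(if ((p.1 : EuclideanSpace ℝ (Fin 3)) ∈ Dp) then (1 : ℂ) else -1) * echar Λ (-p.2) ((ℝ ∙ u)ᗮ.orthogonalProjectionOnto (p.1 : EuclideanSpace ℝ (Fin 3))) *
        𝓕 (fun v : (ℝ ∙ u)ᗮ => ((((⟪(ℝ ∙ u)ᗮ.orthogonalProjectionOnto e, v⟫ + (-(X + (⟪(p.1 : EuclideanSpace ℝ (Fin 3)), u⟫ - a))) * ⟪e, u⟫) *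
          ((‖v‖ ^ 2 + (-(X + (⟪(p.1 : EuclideanSpace ℝ (Fin 3)), u⟫ - a))) ^ 2) ^ (-(4 : ℝ)) -
            (‖v‖ ^ 2 + (-(X + (⟪(p.1 : EuclideanSpace ℝ (Fin 3)), u⟫ - a))) ^ 2) ^ (-(7 : ℝ)))) : ℝ) : ℂ)) (dualVec Λ p.2)‖) := by
  have hu0 : u ≠ 0 := fun h => by norm_num [h] at hu
  obtain ⟨Kc, hKc0, hKc⟩ := hbl_exists_norm_fourierIntegral_slice_le (V := (ℝ ∙ u)ᗮ) (hbl_finrank_orthogonal_span_singleton hu0) hX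
  obtain ⟨N, hN⟩ := hbl_exists_reps_height_count hu Λ hδ
  have ha : ∀ y ∈ Dp ∪ Dm, a ≤ ⟪y, u⟫ := fun y hy => hy.elim (hap y) (ham y)
  -- the `q`-profile: polynomial height sum (at most `N + N` representatives per height window)
  have hG := hbl_summable_reps_inv_pow_four Λ ha (N := N + N) (fun Y => by
    push_cast
    refine (Set.encard_le_encard ?_).trans ((Set.encard_union_le _ _).trans (add_le_add (hN Dp hsepp Y) (hN Dm hsepm Y)))
    rintro q ⟨⟨hq | hq, hf⟩, hw⟩
    exacts [Or.inl ⟨⟨hq, hf⟩, hw⟩, Or.inr ⟨⟨hq, hf⟩, hw⟩]) hX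
  -- the `k`-profile
  set c : ℝ := Real.pi * X with hc_def
  have hc : 0 < c := by positivity
  set F : (Fin (Module.finrank ℝ (ℝ ∙ u)ᗮ) → ℤ) → ℝ := fun k =>
    Kc * (‖(ℝ ∙ u)ᗮ.orthogonalProjectionOnto e‖ * ‖dualVec Λ k‖ + |⟪e, u⟫|) * Real.exp (-c * ‖dualVec Λ k‖) with hF_def
  have hF : Summable F := by
    refine Summable.of_nonneg_of_le (fun k => by positivity) (fun k => ?_)
      ((((summable_exp_neg_mul_norm_dualVec Λ (half_pos hc)).mul_left (2 / c)).mul_left (Kc * ‖(ℝ ∙ u)ᗮ.orthogonalProjectionOnto e‖)).add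
        ((summable_exp_neg_mul_norm_dualVec Λ hc).mul_left (Kc * |⟪e, u⟫|)))
    set t : ℝ := ‖dualVec Λ k‖
    have ht : t ≤ 2 / c * Real.exp (c / 2 * t) := by
      rw [div_mul_eq_mul_div, le_div_iff₀ hc]; nlinarith [Real.add_one_le_exp (c / 2 * t)]
    have key : t * Real.exp (-c * t) ≤ 2 / c * Real.exp (-(c / 2) * t) :=
      calc t * Real.exp (-c * t) ≤ 2 / c * Real.exp (c / 2 * t) * Real.exp (-c * t) :=
            mul_le_mul_of_nonneg_right ht (Real.exp_pos _).le
        _ = 2 / c * Real.exp (-(c / 2) * t) := by rw [mul_assoc, ← Real.exp_add]; ring_nf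
    calc F k = Kc * ‖(ℝ ∙ u)ᗮ.orthogonalProjectionOnto e‖ * (t * Real.exp (-c * t)) + Kc * |⟪e, u⟫| * Real.exp (-c * t) := by rw [hF_def]; ring
      _ ≤ Kc * ‖(ℝ ∙ u)ᗮ.orthogonalProjectionOnto e‖ * (2 / c * Real.exp (-(c / 2) * t)) + Kc * |⟪e, u⟫| * Real.exp (-c * t) := by gcongr
  refine Summable.of_nonneg_of_le (fun p => norm_nonneg _) (fun p => ?_)
    (hG.mul_of_nonneg hF (fun q => by positivity) (fun k => by positivity))
  obtain ⟨q, k⟩ := p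
  have hq : (q : EuclideanSpace ℝ (Fin 3)) ∈ Dp ∪ Dm := q.2.1
  have hη : 0 ≤ ⟪(q : EuclideanSpace ℝ (Fin 3)), u⟫ - a := sub_nonneg.2 (ha _ hq)
  have hτ : |(-(X + (⟪(q : EuclideanSpace ℝ (Fin 3)), u⟫ - a)))| = X + (⟪(q : EuclideanSpace ℝ (Fin 3)), u⟫ - a) := by rw [abs_neg, abs_of_pos (by linarith)]
  have hε1 : ‖(if (q : EuclideanSpace ℝ (Fin 3)) ∈ Dp then (1 : ℂ) else -1)‖ = 1 := by split_ifs <;> simp only [norm_neg, norm_one]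
  dsimp only; rw [norm_mul, norm_mul, norm_echar, mul_one, hε1, one_mul]
  refine (hKc _ _ _ (by rw [hτ]; linarith) (dualVec Λ k)).trans ?_; rw [hτ]
  have hexp : Real.exp (-(Real.pi * ‖dualVec Λ k‖ * (X + (⟪(q : EuclideanSpace ℝ (Fin 3)), u⟫ - a)))) ≤ Real.exp (-c * ‖dualVec Λ k‖) :=
    Real.exp_le_exp.2 (by rw [hc_def]; nlinarith [mul_nonneg (mul_nonneg Real.pi_pos.le (norm_nonneg (dualVec Λ k))) hη])
  calc _ ≤ Kc * (‖(ℝ ∙ u)ᗮ.orthogonalProjectionOnto e‖ * ‖dualVec Λ k‖ + |⟪e, u⟫|) * (X + (⟪(q : EuclideanSpace ℝ (Fin 3)), u⟫ - a))⁻¹ ^ 4 * Real.exp (-c * ‖dualVec Λ k‖) :=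
        mul_le_mul_of_nonneg_left hexp (by positivity)
    _ = _ := by rw [hF_def]; ring

include hu hδ hsepp hsepm hap ham hDp hDm in
/-- **Mode expansion of the signed field on a horizontal plane** (binder form of the registered
`hbl_signedField_hasSum_modes`): for `e`, `b ∈ W`, `X > 0` and `z = b + (a − X)u`,
`∑_{y ∈ Dp ∪ Dm} ε_y ⟪e, K(z − y)⟫ = (vol fdom)⁻¹ ∑ₖ (∑_q ε_q e_{−k}(P q) 𝓕[slice_q](dualVec Λ k)) e_k(b)`,
`slice_q(v) = (⟪P e, v⟫ + τ_q ⟪e,u⟫)((‖v‖² + τ_q²)^{-4} − (‖v‖² + τ_q²)^{-7})`, `τ_q = −(X + ⟪q,u⟫ − a)` (Poisson summation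
for the family `(ε_q slice_q(· − P q))_q` along `reps × Λ ≃ Dp ∪ Dm`). [folklore] -/
theorem hbl_signedField_hasSum_modes' (e : EuclideanSpace ℝ (Fin 3)) (b : (ℝ ∙ u)ᗮ) {X : ℝ} (hX : 0 < X) (z : EuclideanSpace ℝ (Fin 3))
    (hz : z = (b : EuclideanSpace ℝ (Fin 3)) + (a - X) • u) :
    HasSum (fun k : Fin (Module.finrank ℝ (ℝ ∙ u)ᗮ) → ℤ => (((volume.real (fdom Λ))⁻¹ : ℝ) : ℂ) *
        (∑' q : {q : EuclideanSpace ℝ (Fin 3) // q ∈ Dp ∪ Dm ∧ (ℝ ∙ u)ᗮ.orthogonalProjectionOnto q ∈ fdom Λ}, (if ((q : EuclideanSpace ℝ (Fin 3)) ∈ Dp) then (1 : ℂ) else -1) *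
          echar Λ (-k) ((ℝ ∙ u)ᗮ.orthogonalProjectionOnto (q : EuclideanSpace ℝ (Fin 3))) *
            𝓕 (fun v : (ℝ ∙ u)ᗮ => ((((⟪(ℝ ∙ u)ᗮ.orthogonalProjectionOnto e, v⟫ + (-(X + (⟪(q : EuclideanSpace ℝ (Fin 3)), u⟫ - a))) * ⟪e, u⟫) *
            ((‖v‖ ^ 2 + (-(X + (⟪(q : EuclideanSpace ℝ (Fin 3)), u⟫ - a))) ^ 2) ^ (-(4 : ℝ)) -
              (‖v‖ ^ 2 + (-(X + (⟪(q : EuclideanSpace ℝ (Fin 3)), u⟫ - a))) ^ 2) ^ (-(7 : ℝ)))) : ℝ) : ℂ)) (dualVec Λ k)) * echar Λ k b)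
      (∑' y : ↥(Dp ∪ Dm), (if (y : EuclideanSpace ℝ (Fin 3)) ∈ Dp then (1 : ℂ) else -1) *
        ((⟪e, ((((‖z - (y : EuclideanSpace ℝ (Fin 3))‖ ^ 2) ^ 4)⁻¹ - ((‖z - (y : EuclideanSpace ℝ (Fin 3))‖ ^ 2) ^ 7)⁻¹) • (z - (y : EuclideanSpace ℝ (Fin 3))))⟫ : ℝ) : ℂ)) := by
  haveI := hbl_countable_signedReps Λ hδ hsepp hsepm
  have hu0 : u ≠ 0 := fun h => by norm_num [h] at hu
  have hV := hbl_finrank_orthogonal_span_singleton hu0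
  have ha : ∀ y ∈ Dp ∪ Dm, a ≤ ⟪y, u⟫ := fun y hy => hy.elim (hap y) (ham y)
  have hD : ∀ ℓ : Λ, ∀ y : EuclideanSpace ℝ (Fin 3), y + ((ℓ : (ℝ ∙ u)ᗮ) : EuclideanSpace ℝ (Fin 3)) ∈ Dp ∪ Dm ↔ y ∈ Dp ∪ Dm := fun ℓ y => or_congr (hDp ℓ y) (hDm ℓ y)
  obtain ⟨C, hC⟩ := (fdom_isBounded Λ).exists_norm_le
  -- abbreviations (plain `let`s: cheap to elaborate, transparent to unification)
  let T := {q : EuclideanSpace ℝ (Fin 3) // q ∈ Dp ∪ Dm ∧ (ℝ ∙ u)ᗮ.orthogonalProjectionOnto q ∈ fdom Λ}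
  let K : EuclideanSpace ℝ (Fin 3) → EuclideanSpace ℝ (Fin 3) := fun y => (((‖y‖ ^ 2) ^ 4)⁻¹ - ((‖y‖ ^ 2) ^ 7)⁻¹) • y
  let ε : EuclideanSpace ℝ (Fin 3) → ℂ := fun y => if y ∈ Dp then (1 : ℂ) else -1
  let τ : EuclideanSpace ℝ (Fin 3) → ℝ := fun y => -(X + (⟪y, u⟫ - a))
  let S : T → (ℝ ∙ u)ᗮ → ℂ := fun q v => ((((⟪(ℝ ∙ u)ᗮ.orthogonalProjectionOnto e, v⟫ + τ q * ⟪e, u⟫) *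
    ((‖v‖ ^ 2 + τ (q : EuclideanSpace ℝ (Fin 3)) ^ 2) ^ (-(4 : ℝ)) - (‖v‖ ^ 2 + τ (q : EuclideanSpace ℝ (Fin 3)) ^ 2) ^ (-(7 : ℝ)))) : ℝ) : ℂ)
  let h : T → (ℝ ∙ u)ᗮ → ℂ := fun q v => ε q * S q (v - (ℝ ∙ u)ᗮ.orthogonalProjectionOnto (q : EuclideanSpace ℝ (Fin 3)))
  let R : ℝ := |C| + 1
  let z₀ : EuclideanSpace ℝ (Fin 3) := (a - X) • u
  let Cst : ℝ := (1 + X⁻¹ ^ 6) * (‖(ℝ ∙ u)ᗮ.orthogonalProjectionOnto e‖ + |⟪e, u⟫|)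
  obtain ⟨Φ, hΦ⟩ : ∃ Φ : T × Λ ≃ ↥(Dp ∪ Dm), ∀ q ℓ, ((Φ (q, ℓ) : ↥(Dp ∪ Dm)) : EuclideanSpace ℝ (Fin 3)) = q + ((-(ℓ : (ℝ ∙ u)ᗮ) : (ℝ ∙ u)ᗮ) : EuclideanSpace ℝ (Fin 3)) := by
    obtain ⟨Φ₀, hΦ₀⟩ := hbl_exists_repsEquiv Λ hD
    exact ⟨(Equiv.prodCongr (Equiv.refl T) (Equiv.neg Λ)).trans Φ₀, fun q ℓ => by
      rw [← Submodule.coe_neg]; exact hΦ₀ q (-ℓ)⟩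
  let M : T → Λ → ℝ := fun q ℓ => Cst * ((max X (dist ((Φ (q, ℓ) : ↥(Dp ∪ Dm)) : EuclideanSpace ℝ (Fin 3)) z₀ / 2 - R))⁻¹) ^ 7
  -- elementary facts
  have hτX : ∀ y ∈ Dp ∪ Dm, X ≤ |τ y| := fun y hy => by
    dsimp only [τ]; rw [abs_neg, abs_of_pos (by linarith [ha y hy])]; linarith [ha y hy]
  have hτ0 : ∀ y ∈ Dp ∪ Dm, τ y ≠ 0 := fun y hy => abs_pos.1 (hX.trans_le (hτX y hy))
  have hε1 : ∀ y, ‖ε y‖ = 1 := fun y => by dsimp only [ε]; split_ifs <;> simp only [norm_neg, norm_one]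
  have hR : ∀ x ∈ fdom Λ, ‖x‖ + 1 ≤ R := fun x hx => by linarith [hC x hx, le_abs_self C]
  -- hypotheses of the family Poisson summation formula
  have hc : ∀ q, Continuous (h q) := fun q => continuous_const.mul (Complex.continuous_ofReal.comp
    ((hbl_continuous_slice ((ℝ ∙ u)ᗮ.orthogonalProjectionOnto e) ⟪e, u⟫ (hτ0 _ q.2.1)).comp (continuous_sub_right _)))
  have hint : ∀ q, Integrable (h q) := fun q =>
    ((hbl_integrable_slice hV ((ℝ ∙ u)ᗮ.orthogonalProjectionOnto e) ⟪e, u⟫ (hτ0 _ q.2.1)).comp_sub_right ((ℝ ∙ u)ᗮ.orthogonalProjectionOnto (q : EuclideanSpace ℝ (Fin 3)))).const_mul (ε q)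
  have hM : Summable (Function.uncurry M) :=
    (Φ.summable_iff (f := fun y : ↥(Dp ∪ Dm) => Cst * ((max X (dist (y : EuclideanSpace ℝ (Fin 3)) z₀ / 2 - R))⁻¹) ^ 7)).2
      (hbl_summable_majorant_union hδ hsepp hsepm R hX (by positivity) z₀)
  have hbd : ∀ (q : T) (ℓ : Λ) (x : (ℝ ∙ u)ᗮ), ‖x‖ ≤ R → ‖h q (x + ℓ)‖ ≤ M q ℓ := by
    intro q ℓ x hx
    dsimp only [M, h]; rw [norm_mul, hε1, one_mul]
    dsimp only [S]; rw [Complex.norm_real, hΦ]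
    exact hbl_norm_slice_translate_le hu _ x ℓ _ hX (ha _ q.2.1) hx
  have hFou : ∀ (q : T) (k : Fin (Module.finrank ℝ (ℝ ∙ u)ᗮ) → ℤ),
      𝓕 (h q) (dualVec Λ k) = ε q * echar Λ (-k) ((ℝ ∙ u)ᗮ.orthogonalProjectionOnto (q : EuclideanSpace ℝ (Fin 3))) * 𝓕 (S q) (dualVec Λ k) := fun q k =>
    hbl_fourier_const_mul_translate Λ (ε q) (S q) _ k
  have hF : Summable fun p : T × (Fin (Module.finrank ℝ (ℝ ∙ u)ᗮ) → ℤ) => ‖𝓕 (h p.1) (dualVec Λ p.2)‖ := by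
    simp_rw [hFou]
    exact hbl_signedModes_summable_norm hu Λ hδ hsepp hsepm hap ham e hX
  have main := hasSum_echar_tsum_tsum_of_summable Λ hc hint hM hR hbd hF b
  -- identification of the two sides
  have hpt : ∀ (q : T) (ℓ : Λ), h q (b + ℓ) = ε (Φ (q, ℓ)) * ((⟪e, K (z - (Φ (q, ℓ) : ↥(Dp ∪ Dm)))⟫ : ℝ) : ℂ) := by
    intro q ℓ
    have hgeo : z - ((Φ (q, ℓ) : ↥(Dp ∪ Dm)) : EuclideanSpace ℝ (Fin 3)) = ((b + (ℓ : (ℝ ∙ u)ᗮ) -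
        (ℝ ∙ u)ᗮ.orthogonalProjectionOnto (q : EuclideanSpace ℝ (Fin 3)) : (ℝ ∙ u)ᗮ) : EuclideanSpace ℝ (Fin 3)) + τ (q : EuclideanSpace ℝ (Fin 3)) • u := by
      rw [hΦ, hz]; exact hbl_plane_decomp hu b ℓ q a X
    have hmem : ((Φ (q, ℓ) : ↥(Dp ∪ Dm)) : EuclideanSpace ℝ (Fin 3)) ∈ Dp ↔ (q : EuclideanSpace ℝ (Fin 3)) ∈ Dp := by rw [hΦ, ← Submodule.coe_neg]; exact hDp (-ℓ) q
    have hεq : ε (Φ (q, ℓ)) = ε q := by dsimp only [ε]; rw [hmem]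
    rw [hεq]; dsimp only [K]
    rw [hgeo, hbl_inner_kernel_coe_add_smul hu e _ (hτ0 _ q.2.1)]
  have h2 : ∑' p : T × Λ, h p.1 (b + p.2) = ∑' q, ∑' ℓ : Λ, h q (b + ℓ) := main.1.tsum_prod
  have hrhs : ∑' y : ↥(Dp ∪ Dm), ε y * ((⟪e, K (z - y)⟫ : ℝ) : ℂ) = ∑' q, ∑' ℓ : Λ, h q (b + ℓ) := by
    rw [← h2, ← Φ.tsum_eq]
    exact tsum_congr fun p => (hpt p.1 p.2).symm
  -- restate both identifications in the syntactic form of the goal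
  have hlhs : ∀ k : Fin (Module.finrank ℝ (ℝ ∙ u)ᗮ) → ℤ,
      (∑' q : {q : EuclideanSpace ℝ (Fin 3) // q ∈ Dp ∪ Dm ∧ (ℝ ∙ u)ᗮ.orthogonalProjectionOnto q ∈ fdom Λ}, (if ((q : EuclideanSpace ℝ (Fin 3)) ∈ Dp) then (1 : ℂ) else -1) *
          echar Λ (-k) ((ℝ ∙ u)ᗮ.orthogonalProjectionOnto (q : EuclideanSpace ℝ (Fin 3))) *
            𝓕 (fun v : (ℝ ∙ u)ᗮ => ((((⟪(ℝ ∙ u)ᗮ.orthogonalProjectionOnto e, v⟫ + (-(X + (⟪(q : EuclideanSpace ℝ (Fin 3)), u⟫ - a))) * ⟪e, u⟫) *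
            ((‖v‖ ^ 2 + (-(X + (⟪(q : EuclideanSpace ℝ (Fin 3)), u⟫ - a))) ^ 2) ^ (-(4 : ℝ)) -
              (‖v‖ ^ 2 + (-(X + (⟪(q : EuclideanSpace ℝ (Fin 3)), u⟫ - a))) ^ 2) ^ (-(7 : ℝ)))) : ℝ) : ℂ)) (dualVec Λ k)) =
        ∑' q : T, 𝓕 (h q) (dualVec Λ k) := fun k => tsum_congr fun q => (hFou q k).symm
  have hrhs' : (∑' y : ↥(Dp ∪ Dm), (if (y : EuclideanSpace ℝ (Fin 3)) ∈ Dp then (1 : ℂ) else -1) *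
      ((⟪e, ((((‖z - (y : EuclideanSpace ℝ (Fin 3))‖ ^ 2) ^ 4)⁻¹ - ((‖z - (y : EuclideanSpace ℝ (Fin 3))‖ ^ 2) ^ 7)⁻¹) • (z - (y : EuclideanSpace ℝ (Fin 3))))⟫ : ℝ) : ℂ)) =
      ∑' q, ∑' ℓ : Λ, h q (b + ℓ) := hrhs
  simp_rw [hlhs]; rw [hrhs']; exact main.2

end Modes

open FourierTransform renaming fourier → Real.fourierIntegral in
/-- **Mode expansion of the signed field on a horizontal plane** (registered form; the registry spells Mathlib's
`𝓕 = FourierTransform.fourier` by its former name `Real.fourierIntegral`, aliased by the `open … renaming` above so that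
the registered header elaborates verbatim): for two disjoint `Λ`-invariant `δ`-separated `Dp, Dm ⊆ {⟪y,u⟫ ≥ a}`, `e`,
`b ∈ (ℝ ∙ u)ᗮ`, `X > 0`, `z = b + (a − X)u`:
`∑_{y ∈ Dp ∪ Dm} ε_y ⟪e, K(z − y)⟫ = (vol fdom)⁻¹ ∑ₖ (∑_q ε_q e_{−k}(P q) 𝓕[slice_q](dualVec Λ k)) e_k(b)`. [folklore] -/
theorem hbl_signedField_hasSum_modes : ∀ {u : EuclideanSpace ℝ (Fin 3)} (hu : ‖u‖ = 1) (Λ : Submodule ℤ (ℝ ∙ u)ᗮ) [DiscreteTopology Λ] [IsZLattice ℝ Λ] {Dp Dm : Set (EuclideanSpace ℝ (Fin 3))} {δ a : ℝ} (hδ : 0 < δ), Disjoint Dp Dm → (∀ x ∈ Dp, ∀ y ∈ Dp, x ≠ y → δ ≤ dist x y) → (∀ x ∈ Dm, ∀ y ∈ Dm, x ≠ y → δ ≤ dist x y) → (∀ y ∈ Dp, a ≤ inner ℝ y u) → (∀ y ∈ Dm, a ≤ inner ℝ y u) → (∀ ℓ : Λ, ∀ y : EuclideanSpace ℝ (Fin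 3), y + ((ℓ : (ℝ ∙ u)ᗮ) : EuclideanSpace ℝ (Fin 3)) ∈ Dp ↔ y ∈ Dp) → (∀ ℓ : Λ, ∀ y : EuclideanSpace ℝ (Fin 3), y + ((ℓ : (ℝ ∙ u)ᗮ) : EuclideanSpace ℝ (Fin 3)) ∈ Dm ↔ y ∈ Dm) → ∀ (e : EuclideanSpace ℝ (Fin 3)) (b : (ℝ ∙ u)ᗮ) {X : ℝ}, 0 < X → ∀ (z : EuclideanSpace ℝ (Fin 3)), z = (b : EuclideanSpace ℝ (Fin 3)) + (a - X) • u → HasSum (fun k : Fin (Module.finrank ℝ (ℝ ∙ u)ᗮ) → ℤ => (((MeasureTheory.volume.real (Literature.Algebra.EuclideanLattices.LatticePeriodic.fdom Λ))⁻¹ : ℝ) : ℂ) * (∑' q : {q : EuclideanSpace ℝ (Fin 3) // q ∈ Dp ∪ Dm ∧ (ℝ ∙ u)ᗮ.orthogonalProjectionOnto q ∈ Literature.Algebra.EuclideanLattices.LatticePeriodic.fdom Λ}, (if ((q : EuclideanSpace ℝ (Fin 3)) ∈ Dp) then (1 : ℂ) else -1) * Literature.Algebra.EuclideanLattices.LatticePeriodic.echar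 Λ (-k) ((ℝ ∙ u)ᗮ.orthogonalProjectionOnto (q : EuclideanSpace ℝ (Fin 3))) * Real.fourierIntegral (fun v : (ℝ ∙ u)ᗮ => ((((inner ℝ ((ℝ ∙ u)ᗮ.orthogonalProjectionOnto e) v + (-(X + (inner ℝ (q : EuclideanSpace ℝ (Fin 3)) u - a))) * inner ℝ e u) * ((‖v‖ ^ 2 + (-(X + (inner ℝ (q : EuclideanSpace ℝ (Fin 3)) u - a))) ^ 2) ^ (-(4 : ℝ)) - (‖v‖ ^ 2 + (-(X + (inner ℝ (q : EuclideanSpace ℝ (Fin 3)) u - a))) ^ 2) ^ (-(7 : ℝ)))) : ℝ) : ℂ)) (Literature.Algebra.EuclideanLattices.LatticePeriodic.dualVec Λ k)) * Literature.Algebra.EuclideanLattices.LatticePeriodic.echar Λ k b) (∑' y : ↥(Dp ∪ Dm), (if (y : EuclideanSpace ℝ (Fin 3)) ∈ Dp then (1 : ℂ) else -1) * ((inner ℝ e (((((‖z - (y : EuclideanSpace ℝ (Fin 3))‖ ^ 2) ^ 4)⁻¹ - ((‖z - (y : EuclideanSpace ℝ (Fin 3))‖ ^ 2) ^ 7)⁻¹)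 • (z - (y : EuclideanSpace ℝ (Fin 3))))) : ℝ) : ℂ)) := by
  intro u hu Λ _ _ Dp Dm δ a hδ _ hsepp hsepm hap ham hDp hDm e b X hX z hz
  exact hbl_signedField_hasSum_modes' hu Λ hδ hsepp hsepm hap ham hDp hDm e b hX z hz

end Summit.AtomisticToContinuum.Crystallization.Theorems.HolmgrenBoyleLind

end
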